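import Literature.Computability.AlgebraicComplexity.AlperBogartVelascoBoxFour
import HarnessLib

/-!
# Route `SymPencil` — the BoxFour equality case, III: row/column-stable spaces are impossible
# (`--supports` stmt-ValiantsHypothesis-5674 `SdcSuperquadratic`; rung `sdc(per_4) ≥ 21`)

Two lemmas for the classification of `8`-dimensional spaces `W` of `4 × 4` matrices with
vanishing `3 × 3` subpermanents (`SymPencilBoxFourEquality`).

* `rowPiece_mem_of_finrank`: if the row-`l`-supported part `A` of `W` has dimension `2` and row `l`
  maps `W` onto a `2`-dimensional space, then `W = A ⊕ {x ∈ W : row_l x = 0}` and `W` is stable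
  under "keep only row `l`".
* `false_of_row_col_stable`: if `W` is stable under keeping any single row AND any single column,
  and every row and every column of `W` spans a space of dimension `≥ 2`, then `W` contains every
  matrix unit `E_{lj}` at which some element of `W` is non-zero; these cells have `≥ 2` per row and
  per column, so three of them are independent (distinct rows and columns), and the `3 × 3`
  subpermanent through them takes the value `1` on `E₁ + E₂ + E₃ ∈ W` — contradiction.
[folklore]
-/

noncomputable section

-- single-conjunct layout: Sub = Summit, duplicated namespace component intended
set_option linter.dupNamespace false

namespace Summit.ValiantsHypothesis.ValiantsHypothesis.Theorems.SymPencilBoxFourToric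

open Module Finset
open Literature.Computability.AlgebraicComplexity
open Literature.Computability.AlgebraicComplexity.AlperBogartVelasco

variable {K : Type*} [Field K]

/-- **Row stability from the `(2,2,2,2)` profile.**  In the row order `e`, if the
row-`e 0`-supported part of `W` has dimension `2`, `row (e 0)` maps `W` onto a `2`-dimensional
space and `dim W = 8`, then keeping only row `e 0` maps `W` into itself. [folklore] -/
theorem rowPiece_mem_of_finrank (W : Submodule K (Fin 4 × Fin 4 → K)) (h8 : finrank K W = 8)
    (e : Equiv.Perm (Fin 4))
    (hA : finrank K ↥(W ⊓ LinearMap.ker (LinearMap.funLeft K K fun j : Fin 4 => (e 3, j)) ⊓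
          LinearMap.ker (LinearMap.funLeft K K fun j : Fin 4 => (e 2, j)) ⊓
          LinearMap.ker (LinearMap.funLeft K K fun j : Fin 4 => (e 1, j))) = 2)
    (hR : finrank K ↥(W.map (LinearMap.funLeft K K fun j : Fin 4 => (e 0, j))) = 2) :
    ∀ x ∈ W, (fun p : Fin 4 × Fin 4 => if p.1 = e 0 then x p else 0) ∈ W := by
  have hcases : ∀ i : Fin 4, i = 0 ∨ i = 1 ∨ i = 2 ∨ i = 3 := by decide
  let ρ : Fin 4 → (Fin 4 × Fin 4 → K) →ₗ[K] (Fin 4 → K) :=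
    fun r => LinearMap.funLeft K K fun j => (r, j)
  have hρ : ∀ r x j, ρ r x j = x (r, j) := fun _ _ _ => rfl
  set A : Submodule K (Fin 4 × Fin 4 → K) :=
    W ⊓ LinearMap.ker (ρ (e 3)) ⊓ LinearMap.ker (ρ (e 2)) ⊓ LinearMap.ker (ρ (e 1)) with hAdef
  let B : Submodule K (Fin 4 × Fin 4 → K) := W ⊓ LinearMap.ker (ρ (e 0))
  have memA : ∀ a ∈ A, a ∈ W ∧ (∀ j, a (e 1, j) = 0) ∧ (∀ j, a (e 2, j) = 0) ∧
      ∀ j, a (e 3, j) = 0 := fun a ha => by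
    simp only [hAdef, Submodule.mem_inf, LinearMap.mem_ker] at ha
    exact ⟨ha.1.1.1, fun j => congr_fun ha.2 j, fun j => congr_fun ha.1.2 j,
      fun j => congr_fun ha.1.1.2 j⟩
  have hB : finrank K B = 6 := by
    have h := finrank_eq_finrank_map_add_finrank_inf_ker W (ρ (e 0))
    change finrank K W = finrank K (W.map (ρ (e 0))) + finrank K B at h
    change finrank K (W.map (ρ (e 0))) = 2 at hR
    omega
  have hAB : A ⊓ B = ⊥ := by
    rw [eq_bot_iff]
    intro x hx
    rw [Submodule.mem_inf] at hx
    obtain ⟨-, h1, h2, h3⟩ := memA x hx.1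
    have h0 : ∀ j, x (e 0, j) = 0 := fun j => by
      have := hx.2
      rw [Submodule.mem_inf, LinearMap.mem_ker] at this
      exact congr_fun this.2 j
    rw [Submodule.mem_bot]
    funext ⟨i, j⟩
    obtain ⟨k, rfl⟩ := e.surjective i
    rcases hcases k with rfl | rfl | rfl | rfl
    · exact h0 j
    · exact h1 j
    · exact h2 j
    · exact h3 j
  have hsup : A ⊔ B = W := by
    apply Submodule.eq_of_le_of_finrank_eq
    · exact sup_le (fun a ha => (memA a ha).1) inf_le_left
    · have h := Submodule.finrank_sup_add_finrank_inf_eq A B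
      rw [hAB, finrank_bot, add_zero, hB] at h
      change finrank K A = 2 at hA
      omega
  intro x hx
  rw [← hsup, Submodule.mem_sup] at hx
  obtain ⟨a, ha, b, hb, rfl⟩ := hx
  obtain ⟨haW, h1, h2, h3⟩ := memA a ha
  have hb0 : ∀ j, b (e 0, j) = 0 := fun j => by
    rw [Submodule.mem_inf, LinearMap.mem_ker] at hb
    exact congr_fun hb.2 j
  have hpiece : (fun p : Fin 4 × Fin 4 => if p.1 = e 0 then (a + b) p else 0) = a := by
    funext ⟨i, j⟩
    by_cases hi : i = e 0
    · rw [if_pos hi, hi, Pi.add_apply, hb0, add_zero]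
    · rw [if_neg hi]
      obtain ⟨k, rfl⟩ := e.surjective i
      rcases hcases k with rfl | rfl | rfl | rfl
      · exact absurd rfl hi
      · exact (h1 j).symm
      · exact (h2 j).symm
      · exact (h3 j).symm
  rw [hpiece]
  exact haW

/-- Three cells of a `4 × 4` grid in distinct rows and columns, from "`≥ 2` cells in every row and
every column" (a König-type step, done by hand). [folklore] -/
theorem exists_three_independent_cells (S : Fin 4 × Fin 4 → Prop)
    (hrow : ∀ l : Fin 4, ∃ j j' : Fin 4, j ≠ j' ∧ S (l, j) ∧ S (l, j'))
    (hcol : ∀ j : Fin 4, ∃ l l' : Fin 4, l ≠ l' ∧ S (l, j) ∧ S (l', j)) :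
    ∃ p₁ p₂ p₃ : Fin 4 × Fin 4, S p₁ ∧ S p₂ ∧ S p₃ ∧ p₁.1 ≠ p₂.1 ∧ p₁.1 ≠ p₃.1 ∧ p₂.1 ≠ p₃.1 ∧
      p₁.2 ≠ p₂.2 ∧ p₁.2 ≠ p₃.2 ∧ p₂.2 ≠ p₃.2 := by
  -- `(0, a)` and `(1, b)` with `b ≠ a`
  obtain ⟨a, -, -, ha, -⟩ := hrow 0
  obtain ⟨b, hb, hba⟩ : ∃ b, S (1, b) ∧ b ≠ a := by
    obtain ⟨j, j', hjj', hj, hj'⟩ := hrow 1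
    by_cases h : j = a
    · exact ⟨j', hj', fun h' => hjj' (h.trans h'.symm)⟩
    · exact ⟨j, hj, h⟩
  -- the two remaining columns `c ≠ d`
  have key : ∀ a b : Fin 4, ∃ c d : Fin 4, c ≠ d ∧ c ≠ a ∧ c ≠ b ∧ d ≠ a ∧ d ≠ b := by decide
  obtain ⟨c, d, hcd, hca, hcb, hda, hdb⟩ := key a b
  -- a cell of column `c` (or `d`) in a row `∉ {0, 1}` finishes; else both columns fill rows `0, 1`
  have hfin : ∀ c', c' ≠ a → c' ≠ b → ∀ l, S (l, c') → l ≠ 0 → l ≠ 1 →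
      ∃ p₁ p₂ p₃ : Fin 4 × Fin 4, S p₁ ∧ S p₂ ∧ S p₃ ∧ p₁.1 ≠ p₂.1 ∧ p₁.1 ≠ p₃.1 ∧ p₂.1 ≠ p₃.1 ∧
        p₁.2 ≠ p₂.2 ∧ p₁.2 ≠ p₃.2 ∧ p₂.2 ≠ p₃.2 :=
    fun c' hc'a hc'b l hl hl0 hl1 =>
      ⟨(0, a), (1, b), (l, c'), ha, hb, hl, by simp, hl0.symm, hl1.symm, hba.symm, hc'a.symm,
        hc'b.symm⟩
  have hcolfill : ∀ c', c' ≠ a → c' ≠ b →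
      (∃ p₁ p₂ p₃ : Fin 4 × Fin 4, S p₁ ∧ S p₂ ∧ S p₃ ∧ p₁.1 ≠ p₂.1 ∧ p₁.1 ≠ p₃.1 ∧ p₂.1 ≠ p₃.1 ∧
        p₁.2 ≠ p₂.2 ∧ p₁.2 ≠ p₃.2 ∧ p₂.2 ≠ p₃.2) ∨ (S (0, c') ∧ S (1, c')) := by
    intro c' hc'a hc'b
    obtain ⟨l, l', hll', hl, hl'⟩ := hcol c'
    by_cases hl01 : l ≠ 0 ∧ l ≠ 1
    · exact Or.inl (hfin c' hc'a hc'b l hl hl01.1 hl01.2)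
    by_cases hl'01 : l' ≠ 0 ∧ l' ≠ 1
    · exact Or.inl (hfin c' hc'a hc'b l' hl' hl'01.1 hl'01.2)
    right
    rw [not_and_or, not_not, not_not] at hl01 hl'01
    rcases hl01 with rfl | rfl <;> rcases hl'01 with rfl | rfl
    · exact absurd rfl hll'
    · exact ⟨hl, hl'⟩
    · exact ⟨hl', hl⟩
    · exact absurd rfl hll'
  rcases hcolfill c hca hcb with h | ⟨h0c, h1c⟩
  · exact h
  rcases hcolfill d hda hdb with h | ⟨h0d, h1d⟩
  · exact h
  -- row `2` has two cells; they avoid the columns `c, d`? no: if one is in `c` or `d` we are done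
  obtain ⟨j, j', hjj', hj, hj'⟩ := hrow 2
  by_cases hjc : j = c
  · subst hjc
    exact ⟨(2, j), (0, d), (1, b), hj, h0d, hb, by simp, by simp, by simp, hcd, hcb, hdb⟩
  by_cases hjd : j = d
  · subst hjd
    exact ⟨(2, j), (0, c), (1, b), hj, h0c, hb, by simp, by simp, by simp, hcd.symm, hdb, hcb⟩
  -- so `j ∈ {a, b}`
  by_cases hja : j = a
  · subst hja
    exact ⟨(2, j), (0, c), (1, d), hj, h0c, h1d, by simp, by simp, by simp, hca.symm, hda.symm,
      hcd⟩
  have hjb : j = b := by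
    have : ∀ j a b c d : Fin 4, c ≠ d → c ≠ a → c ≠ b → d ≠ a → d ≠ b → b ≠ a →
        j ≠ c → j ≠ d → j ≠ a → j = b := by decide
    exact this j a b c d hcd hca hcb hda hdb hba hjc hjd hja
  subst hjb
  exact ⟨(2, j), (0, c), (1, d), hj, h0c, h1d, by simp, by simp, by simp, hcb.symm, hdb.symm,
    hcd⟩

/-- **A row- and column-stable space of `4 × 4` matrices with vanishing `3 × 3` subpermanents
cannot have all its rows and columns of dimension `≥ 2`.**  See the module docstring. [folklore] -/
theorem false_of_row_col_stable (W : Submodule K (Fin 4 × Fin 4 → K))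
    (hW : ∀ x ∈ W, ∀ (r c : Fin 3 → Fin 4), Function.Injective r → Function.Injective c →
      ((Matrix.of fun i j => x (i, j)).submatrix r c).permanent = 0)
    (hrow : ∀ x ∈ W, ∀ l : Fin 4, (fun p : Fin 4 × Fin 4 => if p.1 = l then x p else 0) ∈ W)
    (hcol : ∀ x ∈ W, ∀ j : Fin 4, (fun p : Fin 4 × Fin 4 => if p.2 = j then x p else 0) ∈ W)
    (hR : ∀ l : Fin 4, 2 ≤ finrank K ↥(W.map (LinearMap.funLeft K K fun j : Fin 4 => (l, j))))
    (hC : ∀ j : Fin 4, 2 ≤ finrank K ↥(W.map (LinearMap.funLeft K K fun i : Fin 4 => (i, j)))) :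
    False := by
  classical
  -- matrix units at the non-zero entries of elements of `W` lie in `W`
  let S : Fin 4 × Fin 4 → Prop := fun p => (Pi.single p (1 : K) : Fin 4 × Fin 4 → K) ∈ W
  have hunit : ∀ x ∈ W, ∀ p : Fin 4 × Fin 4, x p ≠ 0 → S p := by
    intro x hx p hp
    have h1 := hcol _ (hrow x hx p.1) p.2
    have hcell : (fun p' : Fin 4 × Fin 4 =>
        if p'.2 = p.2 then (if p'.1 = p.1 then x p' else 0) else 0) = x p • Pi.single p (1 : K) := by
      funext p'
      by_cases h : p' = p
      · subst h; simp
      · have h' : ¬(p'.2 = p.2 ∧ p'.1 = p.1) := fun hh => h (Prod.ext hh.2 hh.1)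
        rw [Pi.smul_apply, Pi.single_eq_of_ne h, smul_zero]
        by_cases h2 : p'.2 = p.2
        · rw [if_pos h2, if_neg (fun h1' => h' ⟨h2, h1'⟩)]
        · rw [if_neg h2]
    rw [hcell] at h1
    have h2 := W.smul_mem (x p)⁻¹ h1
    rwa [smul_smul, inv_mul_cancel₀ hp, one_smul] at h2
  -- every row and every column carries two cells of `S`
  have hrowS : ∀ l : Fin 4, ∃ j j' : Fin 4, j ≠ j' ∧ S (l, j) ∧ S (l, j') := by
    intro l
    by_contra hno
    push Not at hno
    -- at most one cell in row `l`: the row space is `≤ 1`-dimensional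
    have hle1 : finrank K ↥(W.map (LinearMap.funLeft K K fun j : Fin 4 => (l, j))) ≤ 1 := by
      by_cases hex : ∃ j₀, S (l, j₀)
      · obtain ⟨j₀, hj₀⟩ := hex
        have hsub : W.map (LinearMap.funLeft K K fun j : Fin 4 => (l, j)) ≤
            K ∙ (Pi.single j₀ (1 : K) : Fin 4 → K) := by
          rintro _ ⟨x, hx, rfl⟩
          rw [Submodule.mem_span_singleton]
          refine ⟨x (l, j₀), ?_⟩
          funext j
          change x (l, j₀) • (Pi.single j₀ (1 : K) : Fin 4 → K) j = x (l, j)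
          by_cases hj : j = j₀
          · subst hj; simp
          · rw [Pi.single_eq_of_ne hj, smul_zero]
            by_contra hne
            exact hno j₀ j (Ne.symm hj) hj₀ (hunit x hx (l, j) (Ne.symm hne))
        exact (Submodule.finrank_mono hsub).trans ((finrank_span_le_card _).trans (by simp))
      · push Not at hex
        have hbot : W.map (LinearMap.funLeft K K fun j : Fin 4 => (l, j)) = ⊥ := by
          rw [eq_bot_iff]
          rintro _ ⟨x, hx, rfl⟩
          rw [Submodule.mem_bot]
          funext j
          change x (l, j) = 0
          by_contra hne
          exact hex j (hunit x hx (l, j) hne)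
        rw [hbot, finrank_bot]
        exact zero_le_one
    have := hR l
    omega
  have hcolS : ∀ j : Fin 4, ∃ l l' : Fin 4, l ≠ l' ∧ S (l, j) ∧ S (l', j) := by
    intro j
    by_contra hno
    push Not at hno
    have hle1 : finrank K ↥(W.map (LinearMap.funLeft K K fun i : Fin 4 => (i, j))) ≤ 1 := by
      by_cases hex : ∃ l₀, S (l₀, j)
      · obtain ⟨l₀, hl₀⟩ := hex
        have hsub : W.map (LinearMap.funLeft K K fun i : Fin 4 => (i, j)) ≤
            K ∙ (Pi.single l₀ (1 : K) : Fin 4 → K) := by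
          rintro _ ⟨x, hx, rfl⟩
          rw [Submodule.mem_span_singleton]
          refine ⟨x (l₀, j), ?_⟩
          funext i
          change x (l₀, j) • (Pi.single l₀ (1 : K) : Fin 4 → K) i = x (i, j)
          by_cases hi : i = l₀
          · subst hi; simp
          · rw [Pi.single_eq_of_ne hi, smul_zero]
            by_contra hne
            exact hno l₀ i (Ne.symm hi) hl₀ (hunit x hx (i, j) (Ne.symm hne))
        exact (Submodule.finrank_mono hsub).trans ((finrank_span_le_card _).trans (by simp))
      · push Not at hex
        have hbot : W.map (LinearMap.funLeft K K fun i : Fin 4 => (i, j)) = ⊥ := by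
          rw [eq_bot_iff]
          rintro _ ⟨x, hx, rfl⟩
          rw [Submodule.mem_bot]
          funext i
          change x (i, j) = 0
          by_contra hne
          exact hex i (hunit x hx (i, j) hne)
        rw [hbot, finrank_bot]
        exact zero_le_one
    have := hC j
    omega
  -- three independent cells and the `3 × 3` subpermanent through them
  obtain ⟨p₁, p₂, p₃, h₁, h₂, h₃, r12, r13, r23, c12, c13, c23⟩ :=
    exists_three_independent_cells S hrowS hcolS
  set x : Fin 4 × Fin 4 → K := Pi.single p₁ 1 + Pi.single p₂ 1 + Pi.single p₃ 1 with hxdef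
  have hxW : x ∈ W := W.add_mem (W.add_mem h₁ h₂) h₃
  have hinjr : Function.Injective ![p₁.1, p₂.1, p₃.1] := by
    intro a b hab
    fin_cases a <;> fin_cases b <;> simp_all [eq_comm]
  have hinjc : Function.Injective ![p₁.2, p₂.2, p₃.2] := by
    intro a b hab
    fin_cases a <;> fin_cases b <;> simp_all [eq_comm]
  have h := hW x hxW ![p₁.1, p₂.1, p₃.1] ![p₁.2, p₂.2, p₃.2] hinjr hinjc
  have hone : (Matrix.of fun i j => x (i, j)).submatrix ![p₁.1, p₂.1, p₃.1] ![p₁.2, p₂.2, p₃.2] =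
      1 := by
    obtain ⟨a₁, b₁⟩ := p₁
    obtain ⟨a₂, b₂⟩ := p₂
    obtain ⟨a₃, b₃⟩ := p₃
    simp only at r12 r13 r23 c12 c13 c23
    ext i j
    fin_cases i <;> fin_cases j <;>
      simp [hxdef, Pi.single_apply, r12, r13, r23, c12, c13, c23, r12.symm, r13.symm, r23.symm,
        c12.symm, c13.symm, c23.symm]
  rw [hone, Matrix.permanent_one] at h
  exact one_ne_zero h

end Summit.ValiantsHypothesis.ValiantsHypothesis.Theorems.SymPencilBoxFourToric

end
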